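/-
Origin: expansion seat `planner-pub-hodgecm-pv09-g3-0`, handover #4 2026-08-18T05:38:12Z (`HOME/pub-hodgecm-pv09-g3/lean/Pv09g3/EulerBound.lean`, md5 e0790a15, 254 lines);
landed by the gen-6 packager in gate run 23 as `HodgeCM/PerL34/EulerBound.lean` (import ^import Pv[0-9]+g[0-9]+\.→import HodgeCM.PerL34. ×1).
-/
/-
Copyright: HodgeCM publication cell (pub-hodgecm), DAG node N31, seam (I) (prover pv09, generation 3).
Released under the package licence.

# N31 seam (I), fourth file: the binder `hB` (bounded partial products of the local `L¹` norms)
# DISCHARGED from per-place bounds — generic real analysis + the two unramified regimes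

Source under adjudication (NOT cited as a fact; this file PROVES a typed piece of its seam):
PerL v5 = `inputs/2001/summits__hodge-w-picard-modular-quadrilinear-period-galois-
closure__free__y1__paper__paper.tex`, Lemma 4.2(b), proof, tex ll. 608–611 and 628–631, verbatim:

  609–611: ... Each $I_v$ is absolutely convergent ($\U(W_i)(L_{0,v})$ is compact unless $v$
       splits in $L$, where it is $L_{0,v}^\times$ acting on $\cS(L_{0,v}^3)$ by
       $(\omega(y)\phi)(x)=|y|^{3/2}\phi(yx)$ up to a unitary character, so that
       $|\langle\omega_v(y)\varphi_v,\varphi_v\rangle|\ll\min(|y|,|y|^{-1})^{3/2}$) ...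
  628–631: Enlarging $S$, for $v\notin S$ also $\phi_v=\phi^0_v$ and all splitting data are
       unramified, and then $I_v(\phi^0_v)=1$, resp. (at split $v$ ...)
       $I_v(\phi^0_v)=\sum_{n\in\Z}q_v^{-3|n|/2}a_v^{\,n}=(1-q_v^{-3})\,|1-a_vq_v^{-3/2}|^{-2}$
       with $a_v:=\chi'_{i,v}(\varpi_v)\nu_v(\varpi_v)$, $|a_v|=1$. ... the Euler product
       converges absolutely since $\sum_v q_v^{-3/2}<\infty$.

## Position in the DAG / what this file does

pv11's seam theorems (`AdelicFactorisation.hEuler_of_pureTensor`, hence this seat's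
`PureTensor.hEuler_of_fixedVector`, `PureTensor.eulerDatum`, …) carry the binder
`hB : ∃ C, ∀ S ⊇ S₀ ∪ T, ∏_{i∈S} ∫ ‖f_i‖ dν_i ≤ C` — the "Furthermore, if ∏(∫|f_ν|) < ∞" premise
of Leahy Prop. 3.1.9 (ii) — which pv11's docstring (AdelicFactorisation.lean, header) derives
informally from the local `L¹` norms: `= 1` at non-split unramified `v` and
`= Σ_n q_v^{-3|n|/2} = 1 + O(q_v^{-3/2})` at split unramified `v`, with `Σ_v q_v^{-3/2} < ∞`.
Nothing in the package proved it (GAPS pv11-A2 residue (c)).  This file does, in KERNEL: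

* §1 (generic) `prod_le_exp_tsum` : `0 ≤ a_i ≤ 1 + u_i`, `0 ≤ u_i`, `Σ u_i < ∞` ⇒
  `∏_{i∈S} a_i ≤ exp (Σ' u)` for EVERY finite `S`; `exists_prod_le_of_eventually_le` : the same
  with the bound `a_i ≤ 1 + u_i` only OFF a finite set `S₁` and `Summable` on the complement
  (pv13's `summable_t` shape) ⇒ `∃ C, ∀ S, ∏_{i∈S} a_i ≤ C`.
* §2 (the two regimes for the canonical local coefficient `localCoeff B ω φ i g = ⟪φ, ω(ι_i g)φ⟫`):
  `norm_localCoeff_le` : `‖localCoeff‖ ≤ ‖φ‖²` (Cauchy–Schwarz, `ω` unitary);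
  `integral_norm_localCoeff_le_one` : at a place with `ν_i(G_i) ≤ 1` (non-split unramified:
  `U(W_i)(L_{0,v}) = K_v` compact of volume one) and `‖φ‖ = 1`, `∫ ‖localCoeff‖ dν_i ≤ 1`;
  `integrable_localCoeff_of_isFiniteMeasure` : there `localCoeff` is integrable as soon as the
  local orbit map is continuous; `tsum_pow_natAbs_le` : `Σ_{n∈ℤ} t^{|n|} ≤ 1 + 4t` for
  `0 ≤ t ≤ 1/2` (the split unramified `L¹` norm, `a_v` replaced by `|a_v| = 1`; from the LANDED
  Prior C4 `hasSum_eulerFactor` and pv13 `EulerProduct.abs_eulerFactor_sub_one_le`).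
* §3 **`hB_of_places`** : the binder `hB` of `hEuler_of_fixedVector` / `eulerDatum` PRODUCED from:
  a finite set `S₁`, `‖φ‖ = 1`, `ν_i(G_i) ≤ 1` at the non-split `i ∉ S₁`,
  `∫ ‖localCoeff_i‖ ≤ 1 + 4·tOf(q_i)` at the split `i ∉ S₁`, and pv13's
  `Summable (fun i : {j // j ∉ S₁} => tOf (q i))`; `hB_of_places'` : the variant with the split
  bound given as the series identity `∫ ‖localCoeff_i‖ = Σ_n tOf(q_i)^{|n|}` and `2 ≤ q_i`.

RESIDUAL after this file (honest): the split-place `L¹` evaluation / bound itself (local harmonic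
analysis in the Schrödinger model, l. 610–611, 629–630 — pv07/pv10 lineage: shell integration
`UnramifiedFactors.split_integral_eq_tsum` gives exactly the series shape of `hB_of_places'`), the
volume normalisation `ν_i(G_i) ≤ 1` at non-split unramified places (pv09-g2 `ofHaar` normalises
`ν_i(K_i) = 1`; `K_v = U(W_i)(L_{0,v})` there), and `summable_t` (N31g / Landau prime ideal
theorem input, LEMMAS §3).  Nothing is cited; no hypothesis names PerL, QW8 or a 2001-programme
claim.  Imports: this seat's `PureTensorCoeff` + LANDED `HodgeCM.PerL34.EulerProduct` (pv13);
axioms = the standard trio.  Unit `pub-hodgecm-pv09-g3` (DAG-node prover #09, gen 3), 2026-08-18.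
-/
import Summits.HodgeConjecture.HodgeCM.PerL34.PureTensorCoeff
import Summits.HodgeConjecture.HodgeCM.PerL34.EulerProduct_2

set_option autoImplicit false

noncomputable section

open MeasureTheory Set Filter Function Topology Complex

open scoped RestrictedProduct InnerProductSpace

namespace HodgeCM.PerL34.PureTensor

open HodgeCM.PerL34.AdelicFactorisation HodgeCM.Prior.Perl34File.Perl34.C4

/-! ## §1 Generic: bounded partial products from summable excesses -/

section generic

variable {ι : Type*}

/-- `0 ≤ a_i ≤ 1 + u_i`, `0 ≤ u_i`, `Σ u < ∞` ⇒ `∏_{i∈S} a_i ≤ exp (Σ' u)` for every finite `S`. -/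
theorem prod_le_exp_tsum {a u : ι → ℝ} (ha0 : ∀ i, 0 ≤ a i) (hau : ∀ i, a i ≤ 1 + u i)
    (hu0 : ∀ i, 0 ≤ u i) (hu : Summable u) (S : Finset ι) :
    ∏ i ∈ S, a i ≤ Real.exp (∑' i, u i) := by
  calc ∏ i ∈ S, a i ≤ ∏ i ∈ S, Real.exp (u i) :=
        Finset.prod_le_prod (fun i _ => ha0 i) fun i _ =>
          (hau i).trans (by simpa only [add_comm] using Real.add_one_le_exp (u i))
    _ = Real.exp (∑ i ∈ S, u i) := (Real.exp_sum S u).symm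
    _ ≤ Real.exp (∑' i, u i) := Real.exp_le_exp.mpr (hu.sum_le_tsum S fun i _ => hu0 i)

/-- The same with the excess bound only OFF a finite set `S₁` and summability on its complement
(pv13's `summable_t` shape): the partial products are uniformly bounded. -/
theorem exists_prod_le_of_eventually_le {a u : ι → ℝ} (S₁ : Finset ι) (ha0 : ∀ i, 0 ≤ a i)
    (hau : ∀ i, i ∉ S₁ → a i ≤ 1 + u i) (hu0 : ∀ i, i ∉ S₁ → 0 ≤ u i)
    (hu : Summable fun i : {j : ι // j ∉ S₁} => u i.1) :
    ∃ C : ℝ, ∀ S : Finset ι, ∏ i ∈ S, a i ≤ C := by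
  classical
  -- modify `u` on `S₁`
  set u' : ι → ℝ := fun i => if i ∈ S₁ then max (a i - 1) 0 else u i with hu'
  have hu'S : Summable u' := by
    rw [← Finset.summable_compl_iff S₁]
    refine hu.congr fun i => ?_
    simp only [hu', if_neg i.2]
  refine ⟨Real.exp (∑' i, u' i), prod_le_exp_tsum ha0 (fun i => ?_) (fun i => ?_) hu'S⟩
  · by_cases hi : i ∈ S₁
    · simp only [hu', if_pos hi]
      have := le_max_left (a i - 1) 0
      linarith
    · simp only [hu', if_neg hi]
      exact hau i hi
  · by_cases hi : i ∈ S₁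
    · simp only [hu', if_pos hi]
      exact le_max_right _ _
    · simp only [hu', if_neg hi]
      exact hu0 i hi

end generic

/-! ## §2 The two unramified regimes for the canonical local coefficient -/

section regimes

variable {ι : Type*} {G : ι → Type*} [∀ i, Group (G i)] [DecidableEq ι]
  {Sub : ι → Type*} [∀ i, SetLike (Sub i) (G i)] [∀ i, SubgroupClass (Sub i) (G i)]
  (B : ∀ i, Sub i)
  {Sp : Type*} [NormedAddCommGroup Sp] [InnerProductSpace ℂ Sp]
  (ω : (Πʳ j, [G j, B j]) →* (Sp ≃ₗᵢ[ℂ] Sp)) (φ : Sp)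

/-- `|⟪φ, ω(ι_i g)φ⟫| ≤ ‖φ‖²` (Cauchy–Schwarz; `ω` unitary). -/
theorem norm_localCoeff_le (i : ι) (g : G i) : ‖localCoeff B ω φ i g‖ ≤ ‖φ‖ ^ 2 := by
  unfold localCoeff
  calc ‖inner ℂ φ (ω (RestrictedProduct.mulSingle B i g) φ)‖
      ≤ ‖φ‖ * ‖ω (RestrictedProduct.mulSingle B i g) φ‖ := norm_inner_le_norm _ _
    _ = ‖φ‖ ^ 2 := by rw [LinearIsometryEquiv.norm_map, sq]

variable [∀ i, MeasurableSpace (G i)]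

/-- **Non-split unramified regime** (`U(W_i)(L_{0,v}) = K_v` compact, `vol = 1`): if `ν_i(G_i) ≤ 1`
and `‖φ‖ = 1` then `∫ ‖localCoeff_i‖ dν_i ≤ 1` (no integrability needed). -/
theorem integral_norm_localCoeff_le_one (hφ : ‖φ‖ = 1) {i : ι} (ν : Measure (G i))
    (hν : ν Set.univ ≤ 1) : ∫ g, ‖localCoeff B ω φ i g‖ ∂ν ≤ 1 := by
  haveI : IsFiniteMeasure ν := ⟨hν.trans_lt ENNReal.one_lt_top⟩
  have h1 : ∫ g, ‖localCoeff B ω φ i g‖ ∂ν ≤ ∫ _g, (1 : ℝ) ∂ν :=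
    integral_mono_of_nonneg (Eventually.of_forall fun _ => norm_nonneg _) (integrable_const 1)
      (Eventually.of_forall fun g => by
        have := norm_localCoeff_le B ω φ i g
        rw [hφ, one_pow] at this
        exact this)
  have h2 : ∫ _g, (1 : ℝ) ∂ν = ν.real Set.univ := by
    rw [integral_const, smul_eq_mul, mul_one]
  have h3 : ν.real Set.univ ≤ 1 := by
    have := ENNReal.toReal_mono ENNReal.one_ne_top hν
    rwa [ENNReal.toReal_one] at this
  linarith

/-- At a place of finite volume, the canonical local coefficient is integrable as soon as the
local orbit map `g ↦ ω(ι_i g)φ` is continuous (compact places; archimedean places excluded). -/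
theorem integrable_localCoeff_of_isFiniteMeasure [∀ i, TopologicalSpace (G i)]
    [∀ i, OpensMeasurableSpace (G i)] {i : ι} (ν : Measure (G i)) [IsFiniteMeasure ν]
    (hω : Continuous fun g : G i => ω (RestrictedProduct.mulSingle B i g) φ) :
    Integrable (localCoeff B ω φ i) ν := by
  have hc : Continuous (localCoeff B ω φ i) := by
    unfold localCoeff
    exact continuous_const.inner hω
  refine Integrable.mono' (integrable_const (‖φ‖ ^ 2)) hc.aestronglyMeasurable
    (Eventually.of_forall fun g => norm_localCoeff_le B ω φ i g)

end regimes

section split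

/-- The split unramified `L¹` series: `Σ_{n∈ℤ} t^{|n|} = eulerFactor t 1 = (1+t)/(1-t)` (from the
LANDED Prior C4 `hasSum_eulerFactor` at `a = 1`). -/
theorem hasSum_pow_natAbs {t : ℝ} (ht0 : 0 ≤ t) (ht1 : t < 1) :
    HasSum (fun n : ℤ => t ^ n.natAbs) (eulerFactor t 1) := by
  have h := hasSum_eulerFactor ht0 ht1 (a := 1) norm_one
  simp only [one_zpow, mul_one, ← Complex.ofReal_pow] at h
  exact Complex.hasSum_ofReal.mp h

/-- (Ported verbatim from the HodgeCMPerL package; no docstring in the source.) -/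
theorem summable_pow_natAbs {t : ℝ} (ht0 : 0 ≤ t) (ht1 : t < 1) :
    Summable fun n : ℤ => t ^ n.natAbs :=
  (hasSum_pow_natAbs ht0 ht1).summable

/-- **Split unramified regime**: `Σ_{n∈ℤ} t^{|n|} ≤ 1 + 4t` for `0 ≤ t ≤ 1/2` (pv13
`EulerProduct.abs_eulerFactor_sub_one_le` at `a = 1`). -/
theorem tsum_pow_natAbs_le {t : ℝ} (ht0 : 0 ≤ t) (ht : t ≤ 1 / 2) :
    ∑' n : ℤ, t ^ n.natAbs ≤ 1 + 4 * t := by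
  have ht1 : t < 1 := by linarith
  rw [(hasSum_pow_natAbs ht0 ht1).tsum_eq]
  have h := EulerProduct.abs_eulerFactor_sub_one_le ht0 ht (a := 1) norm_one
  rw [abs_le] at h
  linarith [h.2]

/-- The same for pv13's `tOf q = q^{-3/2}`, `2 ≤ q`. -/
theorem tsum_tOf_pow_natAbs_le {q : ℕ} (hq : 2 ≤ q) :
    ∑' n : ℤ, EulerProduct.tOf q ^ n.natAbs ≤ 1 + 4 * EulerProduct.tOf q :=
  tsum_pow_natAbs_le (EulerProduct.tOf_nonneg q) (EulerProduct.tOf_le_half hq)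

end split

/-! ## §3 The binder `hB` PRODUCED -/

section hB

variable {ι : Type*} {G : ι → Type*} [∀ i, Group (G i)] [DecidableEq ι] [∀ i, MeasurableSpace (G i)]
  {Sub : ι → Type*} [∀ i, SetLike (Sub i) (G i)] [∀ i, SubgroupClass (Sub i) (G i)]
  (B : ∀ i, Sub i)
  {Sp : Type*} [NormedAddCommGroup Sp] [InnerProductSpace ℂ Sp]

/-- **`hB` from the places** (tex ll. 609–611, 628–631 — the `L¹` side): with `‖φ‖ = 1`, a finite
set `S₁` of places, volume `≤ 1` at the non-split places off `S₁`, the bound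
`∫ ‖localCoeff_i‖ ≤ 1 + 4·q_i^{-3/2}` at the split places off `S₁`, and `Σ_{i∉S₁} q_i^{-3/2} < ∞`
(pv13 `summable_t`), the partial products of the local `L¹` norms are bounded — the binder `hB` of
`hEuler_of_fixedVector` / `eulerDatum` / pv11 `hEuler_of_pureTensor` (for any `S₀`, `T`). -/
theorem hB_of_places (D : RestrictedProductMeasureDatum ι G (Πʳ j, [G j, B j]))
    (ω : (Πʳ j, [G j, B j]) →* (Sp ≃ₗᵢ[ℂ] Sp)) (φ : Sp) (hφ : ‖φ‖ = 1) (T S₁ : Finset ι)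
    (IsSplit : ι → Prop) (q : ι → ℕ)
    (hns : ∀ i, i ∉ S₁ → ¬IsSplit i → D.ν i Set.univ ≤ 1)
    (hsp : ∀ i, i ∉ S₁ → IsSplit i →
      ∫ g, ‖localCoeff B ω φ i g‖ ∂D.ν i ≤ 1 + 4 * EulerProduct.tOf (q i))
    (hsum : Summable fun i : {j : ι // j ∉ S₁} => EulerProduct.tOf (q i.1)) :
    ∃ C : ℝ, ∀ S : Finset ι, D.S₀ ⊆ S → T ⊆ S →
      ∏ i ∈ S, ∫ g, ‖localCoeff B ω φ i g‖ ∂D.ν i ≤ C := by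
  obtain ⟨C, hC⟩ := exists_prod_le_of_eventually_le (a := fun i => ∫ g, ‖localCoeff B ω φ i g‖ ∂D.ν i)
    (u := fun i => 4 * EulerProduct.tOf (q i)) S₁
    (fun i => integral_nonneg fun _ => norm_nonneg _)
    (fun i hi => by
      by_cases hs : IsSplit i
      · exact hsp i hi hs
      · have h1 := integral_norm_localCoeff_le_one B ω φ hφ (D.ν i) (hns i hi hs)
        have h2 : 0 ≤ 4 * EulerProduct.tOf (q i) := by positivity [EulerProduct.tOf_nonneg (q i)]
        linarith)
    (fun i _ => by positivity [EulerProduct.tOf_nonneg (q i)])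
    (hsum.mul_left 4)
  exact ⟨C, fun S _ _ => hC S⟩

/-- Variant with the split bound in SERIES form (`∫ ‖localCoeff_i‖ = Σ_n q_i^{-3|n|/2}`, the shape
delivered by shell integration, pv10 `UnramifiedFactors.split_integral_eq_tsum`) and `2 ≤ q_i`. -/
theorem hB_of_places' (D : RestrictedProductMeasureDatum ι G (Πʳ j, [G j, B j]))
    (ω : (Πʳ j, [G j, B j]) →* (Sp ≃ₗᵢ[ℂ] Sp)) (φ : Sp) (hφ : ‖φ‖ = 1) (T S₁ : Finset ι)
    (IsSplit : ι → Prop) (q : ι → ℕ) (two_le_q : ∀ i, i ∉ S₁ → 2 ≤ q i)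
    (hns : ∀ i, i ∉ S₁ → ¬IsSplit i → D.ν i Set.univ ≤ 1)
    (hsp : ∀ i, i ∉ S₁ → IsSplit i →
      ∫ g, ‖localCoeff B ω φ i g‖ ∂D.ν i = ∑' n : ℤ, EulerProduct.tOf (q i) ^ n.natAbs)
    (hsum : Summable fun i : {j : ι // j ∉ S₁} => EulerProduct.tOf (q i.1)) :
    ∃ C : ℝ, ∀ S : Finset ι, D.S₀ ⊆ S → T ⊆ S →
      ∏ i ∈ S, ∫ g, ‖localCoeff B ω φ i g‖ ∂D.ν i ≤ C :=
  hB_of_places B D ω φ hφ T S₁ IsSplit q hns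
    (fun i hi hs => (hsp i hi hs).le.trans (tsum_tOf_pow_natAbs_le (two_le_q i hi))) hsum

end hB

end HodgeCM.PerL34.PureTensor

end
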